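import Literature.Analysis.FluidPDE.NSCriticalClosureBesovPathSpace
import Literature.Analysis.FluidPDE.GKPRigidityProofs
import HarnessLib

/-!
# The critical Besov continuation criterion from GKP's Propositions 2.1–2.3 over GKP's path space

Analysis/FluidPDE assembly file (proofs only: no definition, no named fact, no statement of the
tree is changed) for the named fact
`Literature.Analysis.FluidPDE.hasSmoothExtensionPast_of_eHomBesovNorm_bounded`
(`NSCriticalClosure.lean`; Gallagher–Koch–Planchon 2016, Thm. 1, contrapositive for classical
Leray–Hopf solutions from rapidly decaying data).

`NSCriticalClosureBesovPathSpace.lean` records the fact as the consequence of GKP's Theorem 1 over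
Gallagher–Koch–Planchon's own solution class ("GKP solution on `[0, T)`" = Besov mild solution of
the class `(s_p, p, p)` lying in `𝓛^{1:∞}_p[T' < T]`, `MemGKPPathSpace`; "`T = T*`" = no GKP
solution on a longer interval extends it), without the identification `hId` of the tree's wider
class with `NS(u₀)`. The GKP seats have transported Props. 2.1, 2.2, 2.3 to that class — the
hypotheses `hP` of `gkp_exists_criticalElement_of_pathSpace` (`GKPCriticalElementsPathSpace.lean`),
`gkp_criticalElement_tendsto_zero_of_pathSpace` (`GKPCompactnessPathSpace.lean`) and
`gkp_rigidity_of_pathSpace` (`GKPRigidityProofs.lean`) — and these three statements chain **inside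
GKP's class**, exactly as in the printed proof of Theorem 1 (GKP 2016, §2.1, p. 6: "Theorem 1 is an
immediate corollary of the next three statements"; no (1.9) is needed on the diagonal `p = q`):

* `gkpThm1_pathSpace_sup_of_gkpProps_pathSpace : hP1 → hP2 → hP3 → (Thm. 1 over GKP's class, sup
  form)` — if a GKP solution with `T = T* < ∞` had bounded critical norm (`A_c < ∞`), Prop. 2.1
  gives a critical element (a GKP solution with `T = T*` minimising `sup ‖U t‖` among such), Prop. 2.2
  makes it tend to `0` in `𝓢'` at its maximal time, and Prop. 2.3 extends it inside GKP's class —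
  against its maximality;
* `hasSmoothExtensionPast_of_eHomBesovNorm_bounded_of_gkpProps3_pathSpace : hP1 → hP2 → hP3 → _` —
  the continuation criterion, by `hasSmoothExtensionPast_of_eHomBesovNorm_bounded_of_gkpThm1_pathSpace_sup`.

So the discharge of the continuation criterion needs exactly the three printed propositions over
GKP's class (the targets of the seats `gkp_exists_criticalElement`, `gkp_criticalElement_tendsto_zero`,
`gkp_rigidity` after their audits), and neither (1.9) nor the identification `hId`.

## References

* I. Gallagher, G. S. Koch, F. Planchon, *Blow-up of critical Besov norms at a potential
  Navier–Stokes singularity*, Comm. Math. Phys. 343 (2016) 39–82 = arXiv:1407.4156: Thm. 1, §2.1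
  (Props. 2.1–2.3 and "Proof of Theorem 1", p. 6). [GKP2016]
-/

noncomputable section

open MeasureTheory TemperedDistribution Set Function Filter
open _root_.Topology
open scoped SchwartzMap ENNReal NNReal

namespace Literature.Analysis.FluidPDE

/-- **GKP's Theorem 1 over GKP's class from Props. 2.1–2.3 over GKP's class** (Gallagher–Koch–
Planchon 2016, §2.1 "Proof of Theorem 1", p. 6, run inside the class `𝓛^{1:∞}_p[T' < T]`): with
`hP1`, `hP2`, `hP3` the path-space forms of Props. 2.1, 2.2, 2.3 (the hypotheses `hP` of
`gkp_exists_criticalElement_of_pathSpace`, `gkp_criticalElement_tendsto_zero_of_pathSpace`,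
`gkp_rigidity_of_pathSpace`), every GKP solution `(u₀, U₀)` on `[0, T₀)`, `0 < T₀`, with no
extension in GKP's class has `sup_{[0,T₀)} ‖U₀ t‖_{Ḃ^{s_p}_{p,p}} = ∞`, for GKP exponents
`p = 3·2^k - 2` and `ν > 0`. Proof: otherwise `A_c < ∞`; Prop. 2.1 yields a minimiser `(u, U)` on
`[0, T)` with `T = T*`, whose `sup` is at most that of `(u₀, U₀)`, hence finite; Prop. 2.2 gives
`U t → 0` in `𝓢'` as `t ↑ T`; Prop. 2.3 extends `(u, U)` inside GKP's class — contradiction.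
[cite: GKP2016, Thm. 1 and §2.1] -/
theorem gkpThm1_pathSpace_sup_of_gkpProps_pathSpace
    (hP1 : ∀ ⦃ν : ℝ⦄, 0 < ν → ∀ ⦃p : ℝ≥0∞⦄ [Fact (1 ≤ p)], IsGKPExponent p →
      ∀ ⦃T₀ : ℝ⦄ ⦃u₀ : ℝ → EuclideanSpace ℝ (Fin 3) → EuclideanSpace ℝ (Fin 3)⦄
        ⦃U₀ : ℝ → 𝓢'(EuclideanSpace ℝ (Fin 3), EuclideanSpace ℂ (Fin 3))⦄, 0 < T₀ →
        IsBesovMildSolutionOn (-1 + 3 / p.toReal) p p T₀ ν u₀ U₀ → MemGKPPathSpace p p T₀ U₀ →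
        (¬ ∃ T' > T₀, ∃ (v : ℝ → EuclideanSpace ℝ (Fin 3) → EuclideanSpace ℝ (Fin 3))
            (V : ℝ → 𝓢'(EuclideanSpace ℝ (Fin 3), EuclideanSpace ℂ (Fin 3))),
            (IsBesovMildSolutionOn (-1 + 3 / p.toReal) p p T' ν v V ∧ MemGKPPathSpace p p T' V) ∧
              ∀ t ∈ Ico 0 T₀, v t =ᵐ[volume] u₀ t) →
        ⨆ t ∈ Ico 0 T₀, FunctionSpaces.eHomBesovNorm (-1 + 3 / p.toReal) p p (U₀ t) < ∞ →
        ∃ (T : ℝ) (u : ℝ → EuclideanSpace ℝ (Fin 3) → EuclideanSpace ℝ (Fin 3))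
          (U : ℝ → 𝓢'(EuclideanSpace ℝ (Fin 3), EuclideanSpace ℂ (Fin 3))), 0 < T ∧
          IsBesovMildSolutionOn (-1 + 3 / p.toReal) p p T ν u U ∧ MemGKPPathSpace p p T U ∧
          (¬ ∃ T' > T, ∃ (v : ℝ → EuclideanSpace ℝ (Fin 3) → EuclideanSpace ℝ (Fin 3))
              (V : ℝ → 𝓢'(EuclideanSpace ℝ (Fin 3), EuclideanSpace ℂ (Fin 3))),
              (IsBesovMildSolutionOn (-1 + 3 / p.toReal) p p T' ν v V ∧ MemGKPPathSpace p p T' V) ∧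
                ∀ t ∈ Ico 0 T, v t =ᵐ[volume] u t) ∧
          ∀ ⦃T₁ : ℝ⦄ ⦃u₁ : ℝ → EuclideanSpace ℝ (Fin 3) → EuclideanSpace ℝ (Fin 3)⦄
            ⦃U₁ : ℝ → 𝓢'(EuclideanSpace ℝ (Fin 3), EuclideanSpace ℂ (Fin 3))⦄, 0 < T₁ →
            IsBesovMildSolutionOn (-1 + 3 / p.toReal) p p T₁ ν u₁ U₁ → MemGKPPathSpace p p T₁ U₁ →
            (¬ ∃ T' > T₁, ∃ (v : ℝ → EuclideanSpace ℝ (Fin 3) → EuclideanSpace ℝ (Fin 3))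
                (V : ℝ → 𝓢'(EuclideanSpace ℝ (Fin 3), EuclideanSpace ℂ (Fin 3))),
                (IsBesovMildSolutionOn (-1 + 3 / p.toReal) p p T' ν v V ∧
                    MemGKPPathSpace p p T' V) ∧
                  ∀ t ∈ Ico 0 T₁, v t =ᵐ[volume] u₁ t) →
            ⨆ t ∈ Ico 0 T, FunctionSpaces.eHomBesovNorm (-1 + 3 / p.toReal) p p (U t) ≤
              ⨆ t ∈ Ico 0 T₁, FunctionSpaces.eHomBesovNorm (-1 + 3 / p.toReal) p p (U₁ t))
    (hP2 : ∀ ⦃ν : ℝ⦄, 0 < ν → ∀ ⦃p : ℝ≥0∞⦄ [Fact (1 ≤ p)], IsGKPExponent p →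
      ∀ ⦃T : ℝ⦄ ⦃u : ℝ → EuclideanSpace ℝ (Fin 3) → EuclideanSpace ℝ (Fin 3)⦄
        ⦃U : ℝ → 𝓢'(EuclideanSpace ℝ (Fin 3), EuclideanSpace ℂ (Fin 3))⦄, 0 < T →
        IsBesovMildSolutionOn (-1 + 3 / p.toReal) p p T ν u U → MemGKPPathSpace p p T U →
        (¬ ∃ T' > T, ∃ (v : ℝ → EuclideanSpace ℝ (Fin 3) → EuclideanSpace ℝ (Fin 3))
            (V : ℝ → 𝓢'(EuclideanSpace ℝ (Fin 3), EuclideanSpace ℂ (Fin 3))),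
            (IsBesovMildSolutionOn (-1 + 3 / p.toReal) p p T' ν v V ∧ MemGKPPathSpace p p T' V) ∧
              ∀ t ∈ Ico 0 T, v t =ᵐ[volume] u t) →
        ⨆ t ∈ Ico 0 T, FunctionSpaces.eHomBesovNorm (-1 + 3 / p.toReal) p p (U t) < ∞ →
        (∀ ⦃T₁ : ℝ⦄ ⦃u₁ : ℝ → EuclideanSpace ℝ (Fin 3) → EuclideanSpace ℝ (Fin 3)⦄
            ⦃U₁ : ℝ → 𝓢'(EuclideanSpace ℝ (Fin 3), EuclideanSpace ℂ (Fin 3))⦄, 0 < T₁ →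
            IsBesovMildSolutionOn (-1 + 3 / p.toReal) p p T₁ ν u₁ U₁ →
            MemGKPPathSpace p p T₁ U₁ →
            (¬ ∃ T' > T₁, ∃ (v : ℝ → EuclideanSpace ℝ (Fin 3) → EuclideanSpace ℝ (Fin 3))
                (V : ℝ → 𝓢'(EuclideanSpace ℝ (Fin 3), EuclideanSpace ℂ (Fin 3))),
                (IsBesovMildSolutionOn (-1 + 3 / p.toReal) p p T' ν v V ∧
                    MemGKPPathSpace p p T' V) ∧
                  ∀ t ∈ Ico 0 T₁, v t =ᵐ[volume] u₁ t) →
            ⨆ t ∈ Ico 0 T, FunctionSpaces.eHomBesovNorm (-1 + 3 / p.toReal) p p (U t) ≤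
              ⨆ t ∈ Ico 0 T₁, FunctionSpaces.eHomBesovNorm (-1 + 3 / p.toReal) p p (U₁ t)) →
        Tendsto U (𝓝[<] T) (𝓝 0))
    (hP3 : ∀ ⦃ν : ℝ⦄, 0 < ν → ∀ ⦃p : ℝ≥0∞⦄ [Fact (1 ≤ p)], IsGKPExponent p →
      ∀ ⦃T : ℝ⦄ ⦃u : ℝ → EuclideanSpace ℝ (Fin 3) → EuclideanSpace ℝ (Fin 3)⦄
        ⦃U : ℝ → 𝓢'(EuclideanSpace ℝ (Fin 3), EuclideanSpace ℂ (Fin 3))⦄, 0 < T →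
        IsBesovMildSolutionOn (-1 + 3 / p.toReal) p p T ν u U → MemGKPPathSpace p p T U →
        ⨆ t ∈ Ico 0 T, FunctionSpaces.eHomBesovNorm (-1 + 3 / p.toReal) p p (U t) < ∞ →
        Tendsto U (𝓝[<] T) (𝓝 0) →
        ∃ T' > T, ∃ (v : ℝ → EuclideanSpace ℝ (Fin 3) → EuclideanSpace ℝ (Fin 3))
          (V : ℝ → 𝓢'(EuclideanSpace ℝ (Fin 3), EuclideanSpace ℂ (Fin 3))),
          (IsBesovMildSolutionOn (-1 + 3 / p.toReal) p p T' ν v V ∧ MemGKPPathSpace p p T' V) ∧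
            ∀ t ∈ Ico 0 T, v t =ᵐ[volume] u t)
    ⦃ν : ℝ⦄ (hν : 0 < ν) ⦃p : ℝ≥0∞⦄ [Fact (1 ≤ p)] (hp : IsGKPExponent p) ⦃T₀ : ℝ⦄ (hT₀ : 0 < T₀)
    ⦃u₀ : ℝ → EuclideanSpace ℝ (Fin 3) → EuclideanSpace ℝ (Fin 3)⦄
    ⦃U₀ : ℝ → 𝓢'(EuclideanSpace ℝ (Fin 3), EuclideanSpace ℂ (Fin 3))⦄
    (hu₀ : IsBesovMildSolutionOn (-1 + 3 / p.toReal) p p T₀ ν u₀ U₀)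
    (hU₀ : MemGKPPathSpace p p T₀ U₀)
    (hmax₀ : ¬ ∃ T' > T₀, ∃ (v : ℝ → EuclideanSpace ℝ (Fin 3) → EuclideanSpace ℝ (Fin 3))
        (V : ℝ → 𝓢'(EuclideanSpace ℝ (Fin 3), EuclideanSpace ℂ (Fin 3))),
        (IsBesovMildSolutionOn (-1 + 3 / p.toReal) p p T' ν v V ∧ MemGKPPathSpace p p T' V) ∧
          ∀ t ∈ Ico 0 T₀, v t =ᵐ[volume] u₀ t) :
    ⨆ t ∈ Ico 0 T₀, FunctionSpaces.eHomBesovNorm (-1 + 3 / p.toReal) p p (U₀ t) = ∞ := by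
  by_contra hne
  have hlt₀ : ⨆ t ∈ Ico 0 T₀, FunctionSpaces.eHomBesovNorm (-1 + 3 / p.toReal) p p (U₀ t) < ∞ :=
    lt_top_iff_ne_top.2 hne
  -- Prop. 2.1: a critical element over GKP's class
  obtain ⟨T, u, U, hT, hu, hU, hmax, hmin⟩ := hP1 hν hp hT₀ hu₀ hU₀ hmax₀ hlt₀
  -- its critical norm is bounded by that of `(u₀, U₀)`
  have hlt : ⨆ t ∈ Ico 0 T, FunctionSpaces.eHomBesovNorm (-1 + 3 / p.toReal) p p (U t) < ∞ :=
    (hmin hT₀ hu₀ hU₀ hmax₀).trans_lt hlt₀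
  -- Prop. 2.2: it tends to `0` in `𝓢'` at its maximal time
  have hlim : Tendsto U (𝓝[<] T) (𝓝 0) := hP2 hν hp hT hu hU hmax hlt hmin
  -- Prop. 2.3: it extends inside GKP's class — against its maximality
  exact hmax (hP3 hν hp hT hu hU hlt hlim)

/-- **The critical Besov continuation criterion from GKP's Propositions 2.1–2.3 over GKP's path
space.** With `hP1`, `hP2`, `hP3` as in `gkpThm1_pathSpace_sup_of_gkpProps_pathSpace` (Props. 2.1,
2.2, 2.3 of GKP 2016 transported to the class `𝓛^{1:∞}_p[T' < T]`, the hypotheses `hP` of the GKP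
seats' `…_of_pathSpace` reductions), `hasSmoothExtensionPast_of_eHomBesovNorm_bounded` holds — by
Theorem 1 over GKP's class in `sup` form and
`hasSmoothExtensionPast_of_eHomBesovNorm_bounded_of_gkpThm1_pathSpace_sup`. Neither GKP (1.9) nor the
identification of the tree's class `IsBesovMildSolutionOn` with `NS(u₀)` is used.
[cite: GKP2016, Thm. 1 and §2.1] -/
theorem hasSmoothExtensionPast_of_eHomBesovNorm_bounded_of_gkpProps3_pathSpace
    (hP1 : ∀ ⦃ν : ℝ⦄, 0 < ν → ∀ ⦃p : ℝ≥0∞⦄ [Fact (1 ≤ p)], IsGKPExponent p →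
      ∀ ⦃T₀ : ℝ⦄ ⦃u₀ : ℝ → EuclideanSpace ℝ (Fin 3) → EuclideanSpace ℝ (Fin 3)⦄
        ⦃U₀ : ℝ → 𝓢'(EuclideanSpace ℝ (Fin 3), EuclideanSpace ℂ (Fin 3))⦄, 0 < T₀ →
        IsBesovMildSolutionOn (-1 + 3 / p.toReal) p p T₀ ν u₀ U₀ → MemGKPPathSpace p p T₀ U₀ →
        (¬ ∃ T' > T₀, ∃ (v : ℝ → EuclideanSpace ℝ (Fin 3) → EuclideanSpace ℝ (Fin 3))
            (V : ℝ → 𝓢'(EuclideanSpace ℝ (Fin 3), EuclideanSpace ℂ (Fin 3))),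
            (IsBesovMildSolutionOn (-1 + 3 / p.toReal) p p T' ν v V ∧ MemGKPPathSpace p p T' V) ∧
              ∀ t ∈ Ico 0 T₀, v t =ᵐ[volume] u₀ t) →
        ⨆ t ∈ Ico 0 T₀, FunctionSpaces.eHomBesovNorm (-1 + 3 / p.toReal) p p (U₀ t) < ∞ →
        ∃ (T : ℝ) (u : ℝ → EuclideanSpace ℝ (Fin 3) → EuclideanSpace ℝ (Fin 3))
          (U : ℝ → 𝓢'(EuclideanSpace ℝ (Fin 3), EuclideanSpace ℂ (Fin 3))), 0 < T ∧
          IsBesovMildSolutionOn (-1 + 3 / p.toReal) p p T ν u U ∧ MemGKPPathSpace p p T U ∧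
          (¬ ∃ T' > T, ∃ (v : ℝ → EuclideanSpace ℝ (Fin 3) → EuclideanSpace ℝ (Fin 3))
              (V : ℝ → 𝓢'(EuclideanSpace ℝ (Fin 3), EuclideanSpace ℂ (Fin 3))),
              (IsBesovMildSolutionOn (-1 + 3 / p.toReal) p p T' ν v V ∧ MemGKPPathSpace p p T' V) ∧
                ∀ t ∈ Ico 0 T, v t =ᵐ[volume] u t) ∧
          ∀ ⦃T₁ : ℝ⦄ ⦃u₁ : ℝ → EuclideanSpace ℝ (Fin 3) → EuclideanSpace ℝ (Fin 3)⦄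
            ⦃U₁ : ℝ → 𝓢'(EuclideanSpace ℝ (Fin 3), EuclideanSpace ℂ (Fin 3))⦄, 0 < T₁ →
            IsBesovMildSolutionOn (-1 + 3 / p.toReal) p p T₁ ν u₁ U₁ → MemGKPPathSpace p p T₁ U₁ →
            (¬ ∃ T' > T₁, ∃ (v : ℝ → EuclideanSpace ℝ (Fin 3) → EuclideanSpace ℝ (Fin 3))
                (V : ℝ → 𝓢'(EuclideanSpace ℝ (Fin 3), EuclideanSpace ℂ (Fin 3))),
                (IsBesovMildSolutionOn (-1 + 3 / p.toReal) p p T' ν v V ∧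
                    MemGKPPathSpace p p T' V) ∧
                  ∀ t ∈ Ico 0 T₁, v t =ᵐ[volume] u₁ t) →
            ⨆ t ∈ Ico 0 T, FunctionSpaces.eHomBesovNorm (-1 + 3 / p.toReal) p p (U t) ≤
              ⨆ t ∈ Ico 0 T₁, FunctionSpaces.eHomBesovNorm (-1 + 3 / p.toReal) p p (U₁ t))
    (hP2 : ∀ ⦃ν : ℝ⦄, 0 < ν → ∀ ⦃p : ℝ≥0∞⦄ [Fact (1 ≤ p)], IsGKPExponent p →
      ∀ ⦃T : ℝ⦄ ⦃u : ℝ → EuclideanSpace ℝ (Fin 3) → EuclideanSpace ℝ (Fin 3)⦄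
        ⦃U : ℝ → 𝓢'(EuclideanSpace ℝ (Fin 3), EuclideanSpace ℂ (Fin 3))⦄, 0 < T →
        IsBesovMildSolutionOn (-1 + 3 / p.toReal) p p T ν u U → MemGKPPathSpace p p T U →
        (¬ ∃ T' > T, ∃ (v : ℝ → EuclideanSpace ℝ (Fin 3) → EuclideanSpace ℝ (Fin 3))
            (V : ℝ → 𝓢'(EuclideanSpace ℝ (Fin 3), EuclideanSpace ℂ (Fin 3))),
            (IsBesovMildSolutionOn (-1 + 3 / p.toReal) p p T' ν v V ∧ MemGKPPathSpace p p T' V) ∧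
              ∀ t ∈ Ico 0 T, v t =ᵐ[volume] u t) →
        ⨆ t ∈ Ico 0 T, FunctionSpaces.eHomBesovNorm (-1 + 3 / p.toReal) p p (U t) < ∞ →
        (∀ ⦃T₁ : ℝ⦄ ⦃u₁ : ℝ → EuclideanSpace ℝ (Fin 3) → EuclideanSpace ℝ (Fin 3)⦄
            ⦃U₁ : ℝ → 𝓢'(EuclideanSpace ℝ (Fin 3), EuclideanSpace ℂ (Fin 3))⦄, 0 < T₁ →
            IsBesovMildSolutionOn (-1 + 3 / p.toReal) p p T₁ ν u₁ U₁ →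
            MemGKPPathSpace p p T₁ U₁ →
            (¬ ∃ T' > T₁, ∃ (v : ℝ → EuclideanSpace ℝ (Fin 3) → EuclideanSpace ℝ (Fin 3))
                (V : ℝ → 𝓢'(EuclideanSpace ℝ (Fin 3), EuclideanSpace ℂ (Fin 3))),
                (IsBesovMildSolutionOn (-1 + 3 / p.toReal) p p T' ν v V ∧
                    MemGKPPathSpace p p T' V) ∧
                  ∀ t ∈ Ico 0 T₁, v t =ᵐ[volume] u₁ t) →
            ⨆ t ∈ Ico 0 T, FunctionSpaces.eHomBesovNorm (-1 + 3 / p.toReal) p p (U t) ≤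
              ⨆ t ∈ Ico 0 T₁, FunctionSpaces.eHomBesovNorm (-1 + 3 / p.toReal) p p (U₁ t)) →
        Tendsto U (𝓝[<] T) (𝓝 0))
    (hP3 : ∀ ⦃ν : ℝ⦄, 0 < ν → ∀ ⦃p : ℝ≥0∞⦄ [Fact (1 ≤ p)], IsGKPExponent p →
      ∀ ⦃T : ℝ⦄ ⦃u : ℝ → EuclideanSpace ℝ (Fin 3) → EuclideanSpace ℝ (Fin 3)⦄
        ⦃U : ℝ → 𝓢'(EuclideanSpace ℝ (Fin 3), EuclideanSpace ℂ (Fin 3))⦄, 0 < T →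
        IsBesovMildSolutionOn (-1 + 3 / p.toReal) p p T ν u U → MemGKPPathSpace p p T U →
        ⨆ t ∈ Ico 0 T, FunctionSpaces.eHomBesovNorm (-1 + 3 / p.toReal) p p (U t) < ∞ →
        Tendsto U (𝓝[<] T) (𝓝 0) →
        ∃ T' > T, ∃ (v : ℝ → EuclideanSpace ℝ (Fin 3) → EuclideanSpace ℝ (Fin 3))
          (V : ℝ → 𝓢'(EuclideanSpace ℝ (Fin 3), EuclideanSpace ℂ (Fin 3))),
          (IsBesovMildSolutionOn (-1 + 3 / p.toReal) p p T' ν v V ∧ MemGKPPathSpace p p T' V) ∧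
            ∀ t ∈ Ico 0 T, v t =ᵐ[volume] u t) :
    hasSmoothExtensionPast_of_eHomBesovNorm_bounded :=
  hasSmoothExtensionPast_of_eHomBesovNorm_bounded_of_gkpThm1_pathSpace_sup
    fun _ hν _ _ hp _ hT _ _ hu hU hmax =>
      gkpThm1_pathSpace_sup_of_gkpProps_pathSpace hP1 hP2 hP3 hν hp hT hu hU hmax

end Literature.Analysis.FluidPDE

end
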